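import Summits.QuantumFields.YangMills.Theorems.F4SubCurvatureDoorMirrorContinuation
import Mathlib
import HarnessLib

/-!
# Route `F4SubCurvatureDoor`, crux ⟨stmt-QuantumFields-23125⟩ `RationalToGeneral` / parent ⟨23035⟩ `ShortRootRigidity`:
# LINE g17-A «SEXTIC CHANNEL» (planner `ym-idea-3` g17), stub A `MirrorAnalyticity` — part 1/2: sorting into the `B₄` chamber

Bookkeeping for the chamber form of the 24-cell spanning lemma used by stub A (`F4SubCurvatureDoorMirrorAnalyticity`, part 2/2):
* `isSignedPerm_trans`, `isSignedPerm_piLpCongrLeft` — signed permutations (`IsSignedPerm`, the `W(B₄)` class of the route) compose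
  and contain every coordinate permutation;
* `exists_signedPerm_chamber` — every `x ∈ ℝ⁴` is moved by a signed permutation into the closed chamber `x₀ ≥ x₁ ≥ x₂ ≥ x₃ ≥ 0`
  (sign flips `piLpCongrRight`, then the sorting permutation `Tuple.sort` as `piLpCongrLeft`);
* `real_inner_fin_four`, `sum_smul_apply` — coordinates of inner products and of linear combinations in `ℝ⁴`.

Mathlib + tree only; THEOREMS ONLY; no `sorry`; standard axioms.  HONEST FRAMING: elementary support lemmas toward the OPEN crux
23125 / 23035 (`--supports stmt-QuantumFields-23125`); nothing about C3, any rung of LADDER-YM or the mass gap.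
Width seat `ym-line-sfw-p2-w4` g20 (cell ym-idea-1, free hands). [folklore]
-/

set_option autoImplicit false

noncomputable section

namespace Summit.QuantumFields.YangMills.Theorems.F4SubCurvatureDoorGlobalReduction

open scoped InnerProductSpace
open Summit.QuantumFields.YangMills.Cruxes.OSLegsAtWeakCouplingC.Sketch (IsSignedPerm)

/-! ## §1 Sorting by a signed permutation -/

/-- Signed permutations compose. [folklore] -/
theorem isSignedPerm_trans {R S : EuclideanSpace ℝ (Fin 4) ≃ₗᵢ[ℝ] EuclideanSpace ℝ (Fin 4)}
    (hR : IsSignedPerm R) (hS : IsSignedPerm S) : IsSignedPerm (R.trans S) := by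
  intro i
  obtain ⟨j, hj⟩ := hR i
  obtain ⟨k, hk⟩ := hS j
  refine ⟨k, ?_⟩
  rw [LinearIsometryEquiv.trans_apply]
  rcases hj with hj | hj <;> rw [hj] <;> [skip; rw [map_neg]] <;> rcases hk with hk | hk <;> rw [hk]
  · exact Or.inl rfl
  · exact Or.inr rfl
  · exact Or.inr rfl
  · exact Or.inl (neg_neg _)

/-- A coordinate permutation is a signed permutation. [folklore] -/
theorem isSignedPerm_piLpCongrLeft (e : Equiv.Perm (Fin 4)) :
    IsSignedPerm (LinearIsometryEquiv.piLpCongrLeft 2 ℝ ℝ e) := by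
  intro i
  refine ⟨e i, Or.inl ?_⟩
  ext j
  rw [LinearIsometryEquiv.piLpCongrLeft_apply, Equiv.piCongrLeft'_apply, PiLp.single_apply, PiLp.single_apply]
  by_cases h : j = e i
  · rw [if_pos h, if_pos (by rw [h, Equiv.symm_apply_apply])]
  · rw [if_neg h, if_neg (by intro h'; exact h ((Equiv.symm_apply_eq e).1 h'))]

/-- **Every point is `W(B₄)`-conjugate to a point of the closed chamber `x₀ ≥ x₁ ≥ x₂ ≥ x₃ ≥ 0`** (flip the signs, then
sort the moduli). [folklore] -/
theorem exists_signedPerm_chamber (x : EuclideanSpace ℝ (Fin 4)) :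
    ∃ R : EuclideanSpace ℝ (Fin 4) ≃ₗᵢ[ℝ] EuclideanSpace ℝ (Fin 4), IsSignedPerm R ∧
      0 ≤ R x 3 ∧ R x 3 ≤ R x 2 ∧ R x 2 ≤ R x 1 ∧ R x 1 ≤ R x 0 := by
  -- the sign flips
  set S : EuclideanSpace ℝ (Fin 4) ≃ₗᵢ[ℝ] EuclideanSpace ℝ (Fin 4) := LinearIsometryEquiv.piLpCongrRight 2
    (fun i : Fin 4 => if x i < 0 then LinearIsometryEquiv.neg ℝ else LinearIsometryEquiv.refl ℝ ℝ) with hS_def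
  have hS : ∀ (y : EuclideanSpace ℝ (Fin 4)) (i : Fin 4), S y i = if x i < 0 then -y i else y i := by
    intro y i
    simp only [hS_def, LinearIsometryEquiv.piLpCongrRight_apply, PiLp.toLp_apply]
    split_ifs <;> rfl
  have hSx : ∀ i, S x i = |x i| := by
    intro i
    rw [hS]
    split_ifs with h
    · rw [abs_of_neg h]
    · rw [abs_of_nonneg (not_lt.1 h)]
  have hSperm : IsSignedPerm S := by
    intro i
    refine ⟨i, ?_⟩
    by_cases hi : x i < 0
    · right
      ext j
      rw [hS, PiLp.neg_apply, PiLp.single_apply]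
      by_cases hj : j = i
      · subst hj; rw [if_pos hi]
      · rw [if_neg hj]; split_ifs <;> simp
    · left
      ext j
      rw [hS, PiLp.single_apply]
      by_cases hj : j = i
      · subst hj; rw [if_neg hi]
      · rw [if_neg hj]; split_ifs <;> simp
  -- the sorting permutation (decreasing order of the moduli)
  set σ : Equiv.Perm (Fin 4) := Tuple.sort (fun i => |x i|) with hσ
  have hmono : Monotone ((fun i => |x i|) ∘ σ) := Tuple.monotone_sort _
  set e : Equiv.Perm (Fin 4) := (Fin.revPerm.trans σ).symm with he
  set P : EuclideanSpace ℝ (Fin 4) ≃ₗᵢ[ℝ] EuclideanSpace ℝ (Fin 4) := LinearIsometryEquiv.piLpCongrLeft 2 ℝ ℝ e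
    with hP_def
  have hP : ∀ (y : EuclideanSpace ℝ (Fin 4)) (i : Fin 4), P y i = y (σ (Fin.rev i)) := by
    intro y i
    rw [hP_def, LinearIsometryEquiv.piLpCongrLeft_apply, Equiv.piCongrLeft'_apply, he, Equiv.symm_symm,
      Equiv.trans_apply, Fin.revPerm_apply]
  refine ⟨S.trans P, isSignedPerm_trans hSperm (isSignedPerm_piLpCongrLeft e), ?_⟩
  have hR : ∀ i, (S.trans P) x i = |x (σ (Fin.rev i))| := by
    intro i; rw [LinearIsometryEquiv.trans_apply, hP, hSx]
  have hle : ∀ i j : Fin 4, i ≤ j → (S.trans P) x j ≤ (S.trans P) x i := by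
    intro i j hij
    rw [hR, hR]
    exact hmono (Fin.rev_le_rev.2 hij)
  refine ⟨?_, hle 2 3 (by decide), hle 1 2 (by decide), hle 0 1 (by decide)⟩
  rw [hR]; exact abs_nonneg _

/-! ## §2 Coordinates in `ℝ⁴` -/

/-- `⟪y, v⟫` in coordinates. [folklore] -/
theorem real_inner_fin_four (y v : EuclideanSpace ℝ (Fin 4)) :
    ⟪y, v⟫_ℝ = y 0 * v 0 + y 1 * v 1 + y 2 * v 2 + y 3 * v 3 := by
  simp [PiLp.inner_apply, Fin.sum_univ_four, mul_comm]

/-- Coordinates of a linear combination. [folklore] -/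
theorem sum_smul_apply (g : Fin 4 → ℝ) (u : Fin 4 → EuclideanSpace ℝ (Fin 4)) (i : Fin 4) :
    (∑ j, g j • u j) i = ∑ j, g j * u j i := by
  rw [← inner_single_one_right (∑ j, g j • u j) i, sum_inner]
  simp [real_inner_smul_left, inner_single_one_right]

end Summit.QuantumFields.YangMills.Theorems.F4SubCurvatureDoorGlobalReduction

end
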